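import Summits.Ventures.PercRepro.RLSClosedForms

/-!
# C-025 at q = 3: closed forms of the t = 0 planar sums of the lifted rule R₃⁺ for line-free planes (night-3)

Type `t = 0` (outside points `p − 0 = n + 4`, `p = n + 4`).  For the line-free planes `U_{3,g}` the R₃⁺ supply needs the R₃
share sums of a triple / 4-set / 5-set, `z0Sum n = Σ_x C(p−0,x)/C(x+3,3)`, `z1Sum n = Σ_x C(p−0,x)/C(x+4,3)`,
`z2Sum n = Σ_x C(p−0,x)/C(x+5,3)`, and the witness count `w0Sum n = Σ_x C(p−0,x)` (the hard-max share 1 of every ≥ 6-point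
subset), `1 ≤ x ≤ p − 4`.  Closed forms as powers of 2 and binomials (`z0_closed`, `z1_closed`, `z2_closed` — through the partial
fractions `1/C(i+5,3) = 1/C(i+4,3) − (3/4)/C(i+5,4)` and `1/C(i+6,3) = 1/C(i+4,3) − (3/2)/C(i+5,4) + (3/5)/C(i+6,5)`), and as explicit
rational functions (`z0P`, `z1P`, `z2P`, `w0P`).  Same machine as `RLSGenericT3Sums` (t = 3).  No `decide`, no tables.
-/

open PercRepro.NightThree.CF

namespace PercRepro.NightThree.U0

open Finset

/-- `Σ_{y<1} C(N,y) = 1`. -/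
theorem sum_range_one (N : ℕ) : (∑ y ∈ range 1, (N.choose y : ℚ)) = 1 := by simp

/-- `Σ_{y<3} C(N,y) = 1 + N + C(N,2)`. -/
theorem sum_range_three (N : ℕ) : (∑ y ∈ range 3, (N.choose y : ℚ)) = 1 + N + (N.choose 2 : ℚ) := by
  simp [sum_range_succ]

/-- `Σ_{y<6} C(N,y)` spelled out. -/
theorem sum_range_six (N : ℕ) :
    (∑ y ∈ range 6, (N.choose y : ℚ)) = 1 + N + (N.choose 2 : ℚ) + (N.choose 3 : ℚ) + (N.choose 4 : ℚ) + (N.choose 5 : ℚ) := by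
  simp [sum_range_succ]

/-- The witness count at `t = 0`: `Σ_{x=1}^{p−4} C(p−0,x)`. -/
def w0Sum (n : ℕ) : ℚ := ∑ i ∈ range n, ((n + 4).choose (i + 1) : ℚ)

/-- `w0Sum n = 2^{n+4} − 1 − Σ_{y<4} C(n+4,y)`. -/
theorem w0_closed (n : ℕ) : w0Sum n = 2 ^ (n + 4) - 1 - (1 + ((n : ℚ) + 4) + ((n + 4).choose 2 : ℚ) + ((n + 4).choose 3 : ℚ)) := by
  unfold w0Sum
  rw [sum_choose_shift (n + 4) 1 n, sum_choose_Ico (n + 4) 1 (1 + n) (by omega) (by omega)]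
  have ht := sum_choose_tail (n + 4) 4 (by omega)
  rw [show n + 4 + 1 - 4 = 1 + n by omega] at ht
  rw [ht, sum_range_one, sum_range_four]; push_cast; ring

/-- The R₃ share sum of a triple at `t = 0`. -/
def z0Sum (n : ℕ) : ℚ := ∑ i ∈ range n, ((n + 4).choose (i + 1) : ℚ) / ((i + 4).choose 3 : ℚ)

/-- The R₃ share sum of a 4-set at `t = 0`. -/
def z1Sum (n : ℕ) : ℚ := ∑ i ∈ range n, ((n + 4).choose (i + 1) : ℚ) / ((i + 5).choose 3 : ℚ)

/-- The R₃ share sum of a 5-set at `t = 0`. -/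
def z2Sum (n : ℕ) : ℚ := ∑ i ∈ range n, ((n + 4).choose (i + 1) : ℚ) / ((i + 6).choose 3 : ℚ)

/-- The hard-max tie sum at `t = 0`: `Σ_{x=1}^{p−4} C(p−0,x)/(x+1)` (a near-pencil subset `(k-line) ∪ {a}`, `k ≥ 4`, ties with
its `x` competitors `(k-line) ∪ {y}`). -/
def ztieSum (n : ℕ) : ℚ := ∑ i ∈ range n, ((n + 4).choose (i + 1) : ℚ) / ((i : ℚ) + 2)

/-- `ztieSum n = (2^{n+5} − (1 + (n+5)) − Σ_{y<4} C(n+5,y)) / (n+5)`. -/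
theorem ztie_closed (n : ℕ) :
    ztieSum n = (2 ^ (n + 5) - (1 + ((n : ℚ) + 5)) - (1 + ((n : ℚ) + 5) + ((n + 5).choose 2 : ℚ) + ((n + 5).choose 3 : ℚ))) / ((n : ℚ) + 5) := by
  have hn : ((n : ℚ) + 5) ≠ 0 := by positivity
  have hterm : ∀ i ∈ range n, ((n + 4).choose (i + 1) : ℚ) / ((i : ℚ) + 2) =
      ((n + 5).choose (i + 2) : ℚ) / ((n : ℚ) + 5) := by
    intro i _
    have hi : ((i : ℚ) + 2) ≠ 0 := by positivity
    rw [div_eq_div_iff hi hn]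
    have h := Nat.add_one_mul_choose_eq (n + 4) (i + 1)
    rw [show n + 4 + 1 = n + 5 by omega, show i + 1 + 1 = i + 2 by omega] at h
    have h' : ((n : ℚ) + 5) * ((n + 4).choose (i + 1) : ℚ) = ((n + 5).choose (i + 2) : ℚ) * ((i : ℚ) + 2) := by
      exact_mod_cast h
    linear_combination h'
  unfold ztieSum
  rw [sum_congr rfl hterm, ← sum_div, sum_choose_shift (n + 5) 2 n, sum_choose_Ico (n + 5) 2 (2 + n) (by omega) (by omega)]
  have ht := sum_choose_tail (n + 5) 4 (by omega)
  rw [show n + 5 + 1 - 4 = 2 + n by omega] at ht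
  rw [ht, sum_range_two, sum_range_four]
  congr 1
  push_cast
  ring
/-- `C(N,2) = N(N−1)/2` in `ℚ`. -/
theorem choose_two_cast (N : ℕ) : (N.choose 2 : ℚ) = (N : ℚ) * ((N : ℚ) - 1) / 2 := by
  induction N with
  | zero => simp
  | succ m ih =>
    rw [Nat.choose_succ_succ', Nat.choose_one_right]
    push_cast
    rw [ih]; ring

/-- `C(N,3) = N(N−1)(N−2)/6` in `ℚ`. -/
theorem choose_three_cast (N : ℕ) : (N.choose 3 : ℚ) = (N : ℚ) * ((N : ℚ) - 1) * ((N : ℚ) - 2) / 6 := by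
  induction N with
  | zero => simp
  | succ m ih =>
    rw [Nat.choose_succ_succ']
    push_cast
    rw [ih, choose_two_cast]; ring

/-- `C(N,4) = N(N−1)(N−2)(N−3)/24` in `ℚ`. -/
theorem choose_four_cast (N : ℕ) : (N.choose 4 : ℚ) = (N : ℚ) * ((N : ℚ) - 1) * ((N : ℚ) - 2) * ((N : ℚ) - 3) / 24 := by
  induction N with
  | zero => simp
  | succ m ih =>
    rw [Nat.choose_succ_succ']
    push_cast
    rw [ih, choose_three_cast]; ring


/-- `C(N,5) = N(N−1)(N−2)(N−3)(N−4)/120` in `ℚ`. -/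
theorem choose_five_cast (N : ℕ) :
    (N.choose 5 : ℚ) = (N : ℚ) * ((N : ℚ) - 1) * ((N : ℚ) - 2) * ((N : ℚ) - 3) * ((N : ℚ) - 4) / 120 := by
  induction N with
  | zero => simp
  | succ m ih =>
    rw [Nat.choose_succ_succ']
    push_cast
    rw [ih, choose_four_cast]; ring

/-- `1/C(i+5,3) = 1/C(i+4,3) − (3/4)/C(i+5,4)`. -/
theorem inv_choose_five (i : ℕ) :
    (1 : ℚ) / ((i + 5).choose 3 : ℚ) = 1 / ((i + 4).choose 3 : ℚ) - 3 / 4 * (1 / ((i + 5).choose 4 : ℚ)) := by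
  have e1 : ((i + 5).choose 3 : ℚ) = ((i : ℚ) + 5) * ((i : ℚ) + 4) * ((i : ℚ) + 3) / 6 := by
    rw [choose_three_cast]; push_cast; ring
  have e2 : ((i + 4).choose 3 : ℚ) = ((i : ℚ) + 4) * ((i : ℚ) + 3) * ((i : ℚ) + 2) / 6 := by
    rw [choose_three_cast]; push_cast; ring
  have e3 : ((i + 5).choose 4 : ℚ) = ((i : ℚ) + 5) * ((i : ℚ) + 4) * ((i : ℚ) + 3) * ((i : ℚ) + 2) / 24 := by
    rw [choose_four_cast]; push_cast; ring
  rw [e1, e2, e3]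
  have h1 : ((i : ℚ) + 2) ≠ 0 := by positivity
  have h2 : ((i : ℚ) + 3) ≠ 0 := by positivity
  have h3 : ((i : ℚ) + 4) ≠ 0 := by positivity
  have h4 : ((i : ℚ) + 5) ≠ 0 := by positivity
  field_simp
  ring

/-- `1/C(i+6,3) = 1/C(i+4,3) − (3/2)/C(i+5,4) + (3/5)/C(i+6,5)`. -/
theorem inv_choose_six (i : ℕ) :
    (1 : ℚ) / ((i + 6).choose 3 : ℚ) =
      1 / ((i + 4).choose 3 : ℚ) - 3 / 2 * (1 / ((i + 5).choose 4 : ℚ)) + 3 / 5 * (1 / ((i + 6).choose 5 : ℚ)) := by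
  have e1 : ((i + 6).choose 3 : ℚ) = ((i : ℚ) + 6) * ((i : ℚ) + 5) * ((i : ℚ) + 4) / 6 := by
    rw [choose_three_cast]; push_cast; ring
  have e2 : ((i + 4).choose 3 : ℚ) = ((i : ℚ) + 4) * ((i : ℚ) + 3) * ((i : ℚ) + 2) / 6 := by
    rw [choose_three_cast]; push_cast; ring
  have e3 : ((i + 5).choose 4 : ℚ) = ((i : ℚ) + 5) * ((i : ℚ) + 4) * ((i : ℚ) + 3) * ((i : ℚ) + 2) / 24 := by
    rw [choose_four_cast]; push_cast; ring
  have e4 : ((i + 6).choose 5 : ℚ) = ((i : ℚ) + 6) * ((i : ℚ) + 5) * ((i : ℚ) + 4) * ((i : ℚ) + 3) * ((i : ℚ) + 2) / 120 := by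
    rw [choose_five_cast]; push_cast; ring
  rw [e1, e2, e3, e4]
  have h1 : ((i : ℚ) + 2) ≠ 0 := by positivity
  have h2 : ((i : ℚ) + 3) ≠ 0 := by positivity
  have h3 : ((i : ℚ) + 4) ≠ 0 := by positivity
  have h4 : ((i : ℚ) + 5) ≠ 0 := by positivity
  have h5 : ((i : ℚ) + 6) ≠ 0 := by positivity
  field_simp
  ring

/-- `C(n+4,i+1)/C(i+4,3) = C(n+7,i+4)/C(n+7,3)`. -/
theorem ratio_three (n i : ℕ) : ((n + 4).choose (i + 1) : ℚ) / ((i + 4).choose 3 : ℚ) = ((n + 7).choose (i + 4) : ℚ) / ((n + 7).choose 3 : ℚ) := by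
  have hP : (((i + 4).choose 3 : ℕ) : ℚ) ≠ 0 := by exact_mod_cast (Nat.choose_pos (by omega)).ne'
  have hV : (((n + 7).choose 3 : ℕ) : ℚ) ≠ 0 := by exact_mod_cast (Nat.choose_pos (by omega)).ne'
  rw [div_eq_div_iff hP hV]
  have h := Nat.choose_mul (n := n + 7) (k := i + 4) (s := 3) (by omega)
  rw [show n + 7 - 3 = n + 4 by omega, show i + 4 - 3 = i + 1 by omega] at h
  have h' : ((n + 7).choose (i + 4) : ℚ) * ((i + 4).choose 3 : ℚ) = ((n + 7).choose 3 : ℚ) * ((n + 4).choose (i + 1) : ℚ) := by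
    exact_mod_cast h
  linear_combination -h'

/-- `C(n+4,i+1)/C(i+5,4) = C(n+8,i+5)/C(n+8,4)`. -/
theorem ratio_four (n i : ℕ) : ((n + 4).choose (i + 1) : ℚ) / ((i + 5).choose 4 : ℚ) = ((n + 8).choose (i + 5) : ℚ) / ((n + 8).choose 4 : ℚ) := by
  have hP : (((i + 5).choose 4 : ℕ) : ℚ) ≠ 0 := by exact_mod_cast (Nat.choose_pos (by omega)).ne'
  have hV : (((n + 8).choose 4 : ℕ) : ℚ) ≠ 0 := by exact_mod_cast (Nat.choose_pos (by omega)).ne'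
  rw [div_eq_div_iff hP hV]
  have h := Nat.choose_mul (n := n + 8) (k := i + 5) (s := 4) (by omega)
  rw [show n + 8 - 4 = n + 4 by omega, show i + 5 - 4 = i + 1 by omega] at h
  have h' : ((n + 8).choose (i + 5) : ℚ) * ((i + 5).choose 4 : ℚ) = ((n + 8).choose 4 : ℚ) * ((n + 4).choose (i + 1) : ℚ) := by
    exact_mod_cast h
  linear_combination -h'

/-- `C(n+4,i+1)/C(i+6,5) = C(n+9,i+6)/C(n+9,5)`. -/
theorem ratio_five (n i : ℕ) : ((n + 4).choose (i + 1) : ℚ) / ((i + 6).choose 5 : ℚ) = ((n + 9).choose (i + 6) : ℚ) / ((n + 9).choose 5 : ℚ) := by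
  have hP : (((i + 6).choose 5 : ℕ) : ℚ) ≠ 0 := by exact_mod_cast (Nat.choose_pos (by omega)).ne'
  have hV : (((n + 9).choose 5 : ℕ) : ℚ) ≠ 0 := by exact_mod_cast (Nat.choose_pos (by omega)).ne'
  rw [div_eq_div_iff hP hV]
  have h := Nat.choose_mul (n := n + 9) (k := i + 6) (s := 5) (by omega)
  rw [show n + 9 - 5 = n + 4 by omega, show i + 6 - 5 = i + 1 by omega] at h
  have h' : ((n + 9).choose (i + 6) : ℚ) * ((i + 6).choose 5 : ℚ) = ((n + 9).choose 5 : ℚ) * ((n + 4).choose (i + 1) : ℚ) := by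
    exact_mod_cast h
  linear_combination -h'

/-- `Σ_{i<n} C(n+7,i+4)` in closed form. -/
theorem sum_level_four (n : ℕ) :
    (∑ i ∈ range n, ((n + 7).choose (i + 4) : ℚ)) = 2 ^ (n + 7) - (1 + ((n : ℚ) + 7) + ((n + 7).choose 2 : ℚ) + ((n + 7).choose 3 : ℚ)) - (1 + ((n : ℚ) + 7) + ((n + 7).choose 2 : ℚ) + ((n + 7).choose 3 : ℚ)) := by
  rw [sum_choose_shift (n + 7) 4 n, sum_choose_Ico (n + 7) 4 (4 + n) (by omega) (by omega)]
  have ht := sum_choose_tail (n + 7) 4 (by omega)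
  rw [show n + 7 + 1 - 4 = 4 + n by omega] at ht
  rw [ht, sum_range_four]; push_cast; ring

/-- `Σ_{i<n} C(n+8,i+5)` in closed form. -/
theorem sum_level_five (n : ℕ) :
    (∑ i ∈ range n, ((n + 8).choose (i + 5) : ℚ)) = 2 ^ (n + 8) - (1 + ((n : ℚ) + 8) + ((n + 8).choose 2 : ℚ) + ((n + 8).choose 3 : ℚ) + ((n + 8).choose 4 : ℚ)) - (1 + ((n : ℚ) + 8) + ((n + 8).choose 2 : ℚ) + ((n + 8).choose 3 : ℚ)) := by
  rw [sum_choose_shift (n + 8) 5 n, sum_choose_Ico (n + 8) 5 (5 + n) (by omega) (by omega)]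
  have ht := sum_choose_tail (n + 8) 4 (by omega)
  rw [show n + 8 + 1 - 4 = 5 + n by omega] at ht
  rw [ht, sum_range_five, sum_range_four]; push_cast; ring

/-- `Σ_{i<n} C(n+9,i+6)` in closed form. -/
theorem sum_level_six (n : ℕ) :
    (∑ i ∈ range n, ((n + 9).choose (i + 6) : ℚ)) = 2 ^ (n + 9) - (1 + ((n : ℚ) + 9) + ((n + 9).choose 2 : ℚ) + ((n + 9).choose 3 : ℚ) + ((n + 9).choose 4 : ℚ) + ((n + 9).choose 5 : ℚ)) - (1 + ((n : ℚ) + 9) + ((n + 9).choose 2 : ℚ) + ((n + 9).choose 3 : ℚ)) := by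
  rw [sum_choose_shift (n + 9) 6 n, sum_choose_Ico (n + 9) 6 (6 + n) (by omega) (by omega)]
  have ht := sum_choose_tail (n + 9) 4 (by omega)
  rw [show n + 9 + 1 - 4 = 6 + n by omega] at ht
  rw [ht, sum_range_six, sum_range_four]; push_cast; ring

/-- `z0Sum n` in closed form. -/
theorem z0_closed (n : ℕ) :
    z0Sum n = (2 ^ (n + 7) - (1 + ((n : ℚ) + 7) + ((n + 7).choose 2 : ℚ) + ((n + 7).choose 3 : ℚ)) - (1 + ((n : ℚ) + 7) + ((n + 7).choose 2 : ℚ) + ((n + 7).choose 3 : ℚ))) / ((n + 7).choose 3 : ℚ) := by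
  unfold z0Sum
  rw [sum_congr rfl (fun i _ => ratio_three n i), ← sum_div, sum_level_four]

/-- `z1Sum n` in closed form. -/
theorem z1_closed (n : ℕ) :
    z1Sum n = z0Sum n - 3 / 4 * ((2 ^ (n + 8) - (1 + ((n : ℚ) + 8) + ((n + 8).choose 2 : ℚ) + ((n + 8).choose 3 : ℚ) + ((n + 8).choose 4 : ℚ)) - (1 + ((n : ℚ) + 8) + ((n + 8).choose 2 : ℚ) + ((n + 8).choose 3 : ℚ))) / ((n + 8).choose 4 : ℚ)) := by
  unfold z1Sum z0Sum
  have hterm : ∀ i ∈ range n, ((n + 4).choose (i + 1) : ℚ) / ((i + 5).choose 3 : ℚ) =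
      ((n + 4).choose (i + 1) : ℚ) / ((i + 4).choose 3 : ℚ) - 3 / 4 * (((n + 8).choose (i + 5) : ℚ) / ((n + 8).choose 4 : ℚ)) := by
    intro i _
    rw [← ratio_four, div_eq_mul_one_div, inv_choose_five]; ring
  rw [sum_congr rfl hterm, sum_sub_distrib, ← mul_sum, ← sum_div, sum_level_five]

/-- `z2Sum n` in closed form. -/
theorem z2_closed (n : ℕ) :
    z2Sum n = z0Sum n - 3 / 2 * ((2 ^ (n + 8) - (1 + ((n : ℚ) + 8) + ((n + 8).choose 2 : ℚ) + ((n + 8).choose 3 : ℚ) + ((n + 8).choose 4 : ℚ)) - (1 + ((n : ℚ) + 8) + ((n + 8).choose 2 : ℚ) + ((n + 8).choose 3 : ℚ))) / ((n + 8).choose 4 : ℚ))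
      + 3 / 5 * ((2 ^ (n + 9) - (1 + ((n : ℚ) + 9) + ((n + 9).choose 2 : ℚ) + ((n + 9).choose 3 : ℚ) + ((n + 9).choose 4 : ℚ) + ((n + 9).choose 5 : ℚ)) - (1 + ((n : ℚ) + 9) + ((n + 9).choose 2 : ℚ) + ((n + 9).choose 3 : ℚ))) / ((n + 9).choose 5 : ℚ)) := by
  unfold z2Sum z0Sum
  have hterm : ∀ i ∈ range n, ((n + 4).choose (i + 1) : ℚ) / ((i + 6).choose 3 : ℚ) =
      ((n + 4).choose (i + 1) : ℚ) / ((i + 4).choose 3 : ℚ) - 3 / 2 * (((n + 8).choose (i + 5) : ℚ) / ((n + 8).choose 4 : ℚ))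
        + 3 / 5 * (((n + 9).choose (i + 6) : ℚ) / ((n + 9).choose 5 : ℚ)) := by
    intro i _
    rw [← ratio_four, ← ratio_five, div_eq_mul_one_div, inv_choose_six]; ring
  rw [sum_congr rfl hterm, sum_add_distrib, sum_sub_distrib, ← mul_sum, ← mul_sum, ← sum_div, ← sum_div, sum_level_five, sum_level_six]

/-! ## Polynomial forms -/

/-- `Φ(p,3)` as a rational function of `n` and `2^n`. -/
def phiP (n : ℕ) : ℚ :=
  (128 * 2 ^ n - 2 * (1 + ((n : ℚ) + 7) + ((n : ℚ) + 7) * ((n : ℚ) + 6) / 2 + ((n : ℚ) + 7) * ((n : ℚ) + 6) * ((n : ℚ) + 5) / 6)) /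
    (((n : ℚ) + 7) * ((n : ℚ) + 6) * ((n : ℚ) + 5) / 6)


/-- `z0Sum` as a rational function. -/
def z0P (n : ℕ) : ℚ := (128 * 2 ^ n - (1 + ((n : ℚ) + 7) + ((n : ℚ) + 7) * ((n : ℚ) + 6) / 2 + ((n : ℚ) + 7) * ((n : ℚ) + 6) * ((n : ℚ) + 5) / 6) - (1 + ((n : ℚ) + 7) + ((n : ℚ) + 7) * ((n : ℚ) + 6) / 2 + ((n : ℚ) + 7) * ((n : ℚ) + 6) * ((n : ℚ) + 5) / 6)) / (((n : ℚ) + 7) * ((n : ℚ) + 6) * ((n : ℚ) + 5) / 6)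

/-- `(Σ C(n+8,i+5))/C(n+8,4)` as a rational function. -/
def v5P (n : ℕ) : ℚ := (256 * 2 ^ n - (1 + ((n : ℚ) + 8) + ((n : ℚ) + 8) * ((n : ℚ) + 7) / 2 + ((n : ℚ) + 8) * ((n : ℚ) + 7) * ((n : ℚ) + 6) / 6 + ((n : ℚ) + 8) * ((n : ℚ) + 7) * ((n : ℚ) + 6) * ((n : ℚ) + 5) / 24) - (1 + ((n : ℚ) + 8) + ((n : ℚ) + 8) * ((n : ℚ) + 7) / 2 + ((n : ℚ) + 8) * ((n : ℚ) + 7) * ((n : ℚ) + 6) / 6)) / (((n : ℚ) + 8) * ((n : ℚ) + 7) * ((n : ℚ) + 6) * ((n : ℚ) + 5) / 24)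

/-- `(Σ C(n+9,i+6))/C(n+9,5)` as a rational function. -/
def v6P (n : ℕ) : ℚ := (512 * 2 ^ n - (1 + ((n : ℚ) + 9) + ((n : ℚ) + 9) * ((n : ℚ) + 8) / 2 + ((n : ℚ) + 9) * ((n : ℚ) + 8) * ((n : ℚ) + 7) / 6 + ((n : ℚ) + 9) * ((n : ℚ) + 8) * ((n : ℚ) + 7) * ((n : ℚ) + 6) / 24 + ((n : ℚ) + 9) * ((n : ℚ) + 8) * ((n : ℚ) + 7) * ((n : ℚ) + 6) * ((n : ℚ) + 5) / 120) - (1 + ((n : ℚ) + 9) + ((n : ℚ) + 9) * ((n : ℚ) + 8) / 2 + ((n : ℚ) + 9) * ((n : ℚ) + 8) * ((n : ℚ) + 7) / 6)) / (((n : ℚ) + 9) * ((n : ℚ) + 8) * ((n : ℚ) + 7) * ((n : ℚ) + 6) * ((n : ℚ) + 5) / 120)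

/-- `z1Sum` as a rational function. -/
def z1P (n : ℕ) : ℚ := z0P n - 3 / 4 * v5P n

/-- `z2Sum` as a rational function. -/
def z2P (n : ℕ) : ℚ := z0P n - 3 / 2 * v5P n + 3 / 5 * v6P n

/-- `w0Sum` as a rational function. -/
def w0P (n : ℕ) : ℚ := 16 * 2 ^ n - 1 - (1 + ((n : ℚ) + 4) + ((n : ℚ) + 4) * ((n : ℚ) + 3) / 2 + ((n : ℚ) + 4) * ((n : ℚ) + 3) * ((n : ℚ) + 2) / 6)

/-- `phiClosed` as an explicit rational function of `n` and `2^n`. -/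
theorem phiClosed_eq_phiP (n : ℕ) : phiClosed n = phiP n := by
  unfold phiClosed phiP
  rw [choose_three_cast, choose_two_cast]
  push_cast
  rw [pow_add]
  ring_nf


/-- `z0Sum` as an explicit rational function. -/
theorem z0_eq_P (n : ℕ) : z0Sum n = z0P n := by
  rw [z0_closed]; unfold z0P
  simp only [choose_three_cast, choose_two_cast]
  push_cast
  rw [pow_add]
  ring_nf

/-- `z1Sum` as an explicit rational function. -/
theorem z1_eq_P (n : ℕ) : z1Sum n = z1P n := by
  rw [z1_closed, z0_eq_P]; unfold z1P v5P
  simp only [choose_four_cast, choose_three_cast, choose_two_cast]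
  push_cast
  rw [pow_add]
  ring_nf

/-- `z2Sum` as an explicit rational function. -/
theorem z2_eq_P (n : ℕ) : z2Sum n = z2P n := by
  rw [z2_closed, z0_eq_P]; unfold z2P v5P v6P
  simp only [choose_five_cast, choose_four_cast, choose_three_cast, choose_two_cast]
  push_cast
  rw [pow_add, pow_add]
  ring_nf

/-- `w0Sum` as an explicit rational function. -/
theorem w0_eq_P (n : ℕ) : w0Sum n = w0P n := by
  rw [w0_closed]; unfold w0P
  simp only [choose_three_cast, choose_two_cast]
  push_cast
  rw [pow_add]
  ring_nf


/-- `ztieSum` as a rational function. -/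
def ztieP (n : ℕ) : ℚ := (32 * 2 ^ n - (1 + ((n : ℚ) + 5)) - (1 + ((n : ℚ) + 5) + ((n : ℚ) + 5) * ((n : ℚ) + 4) / 2 + ((n : ℚ) + 5) * ((n : ℚ) + 4) * ((n : ℚ) + 3) / 6)) / ((n : ℚ) + 5)

/-- `ztieSum` as an explicit rational function. -/
theorem ztie_eq_P (n : ℕ) : ztieSum n = ztieP n := by
  rw [ztie_closed]; unfold ztieP
  simp only [choose_three_cast, choose_two_cast]
  push_cast
  rw [pow_add]
  ring_nf

end PercRepro.NightThree.U0
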